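import Summits.AtomisticToContinuum.Crystallization.Theses.PalmUnimodularRigidity
import Literature.MathematicalPhysics.StatisticalMechanics.CrystallizationLocalLimit
import Literature.MathematicalPhysics.StatisticalMechanics.CrystallizationSymmetries

/-!
# `ChargedPatternCrystallizes` (item stmt-AtomisticToContinuum-2916)

Route decl `Summit.AtomisticToContinuum.Crystallization.Theses.PalmUnimodularRigidity.ChargedPatternCrystallizes`:

  `GroundStatesChargePeriodic → LennardJonesMinimalDistance → IsCrystallizing lennardJones 3`.

Proof (soft; Blanc–Lewin 2015, §2.1 (16) and §2.2). Let `x^N` be Lennard-Jones ground states and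
`Q` the periodic configuration charged by them (`GroundStatesChargePeriodic`). For every scale
`k` (radius `k + 1`, tolerance `1 / (k + 1)`) a positive density of particles is good for
infinitely many `N`, in particular ONE particle `i_k` of some `x^(N_k)`, `N_k ↑`, is good: its
recentred neighbourhood is two-way matched with `A_k (Q.points - q_k)` for a linear isometry
`A_k` and a base point `q_k ∈ Q.points`. Modulo the lattice of periods the base points take
finitely many values (the motif), so along a subsequence `Q.points - q_k = Q.points - y₀` is a
fixed pattern; by compactness of the isometries of `ℝ³` (closed unit ball of the
finite-dimensional space `ℝ³ →L[ℝ] ℝ³`) a further subsequence has `A_k → A∞`, a linear isometry.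
With `τ_k := -x_(i_k)` the translated configurations are then, for every radius `R` and every
`ε > 0`, eventually two-way `ε`-matched on `‖·‖ ≤ R` with the periodic configuration
`A∞ (Q - y₀)` (`PeriodicConfiguration.translate` / `isometryImage`), and the uniform minimal
distance (`LennardJonesMinimalDistance`) makes
`PeriodicConfiguration.tendsto_sum_of_eventually_near'` applicable: local convergence with
multiplicity `m ≡ 1`.
-/

noncomputable section

open scoped BigOperators Topology
open Filter Set Metric

namespace Summit.AtomisticToContinuum.Crystallization.Theorems

open Literature.MathematicalPhysics.StatisticalMechanics

/-- From a positive density of good particles, frequently in `N`, to ONE good particle,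
frequently in `N` (for `N ≥ 1`, `ρ N > 0` forces the counted set to be non-empty). [folklore] -/
theorem frequently_exists_of_frequently_card {p : (N : ℕ) → Fin N → Prop} {ρ : ℝ} (hρ : 0 < ρ)
    (h : ∃ᶠ N : ℕ in atTop, ρ * (N : ℝ) ≤ (Nat.card {i : Fin N // p N i} : ℝ)) :
    ∃ᶠ N : ℕ in atTop, ∃ i : Fin N, p N i := by
  refine (h.and_eventually (eventually_ge_atTop 1)).mono fun N hN => ?_
  obtain ⟨hN, hN1⟩ := hN
  have hN1' : (1 : ℝ) ≤ N := by exact_mod_cast hN1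
  have hpos : (0 : ℝ) < (Nat.card {i : Fin N // p N i} : ℝ) :=
    lt_of_lt_of_le (by positivity) hN
  have hne : Nonempty {i : Fin N // p N i} := (Nat.card_pos_iff.1 (by exact_mod_cast hpos)).1
  obtain ⟨⟨i, hi⟩⟩ := hne
  exact ⟨i, hi⟩

/-- Pigeonhole: a sequence with values in a finite set takes one of its values infinitely
often. [folklore] -/
theorem exists_frequently_eq_of_forall_mem {α : Type*} {F : Finset α} {y : ℕ → α}
    (hy : ∀ k, y k ∈ F) : ∃ y₀ ∈ F, ∃ᶠ k in atTop, y k = y₀ := by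
  by_contra h
  have hall : ∀ᶠ k in atTop, ∀ y₀ ∈ F, y k ≠ y₀ :=
    (Filter.eventually_all_finset F).2 fun y₀ hy₀ =>
      not_frequently.1 fun hf => h ⟨y₀, hy₀, hf⟩
  obtain ⟨k, hk⟩ := hall.exists
  exact hk (y k) (hy k) rfl

/-- Sequential compactness of the linear isometries of `ℝ³` (the orthogonal group is compact):
every sequence of linear isometries has a subsequence converging, in operator norm, to a linear
isometry. [folklore] -/
theorem exists_subseq_tendsto_linearIsometry
    (A : ℕ → (EuclideanSpace ℝ (Fin 3) →ₗᵢ[ℝ] EuclideanSpace ℝ (Fin 3))) :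
    ∃ ψ : ℕ → ℕ, StrictMono ψ ∧
      ∃ B : EuclideanSpace ℝ (Fin 3) →ₗᵢ[ℝ] EuclideanSpace ℝ (Fin 3),
        Tendsto (fun k => (A (ψ k)).toContinuousLinearMap) atTop
          (𝓝 B.toContinuousLinearMap) := by
  have hmem : ∀ k, (A k).toContinuousLinearMap ∈
      closedBall (0 : EuclideanSpace ℝ (Fin 3) →L[ℝ] EuclideanSpace ℝ (Fin 3)) 1 := fun k =>
    mem_closedBall_zero_iff.2 (A k).norm_toContinuousLinearMap_le
  obtain ⟨T, -, ψ, hψ, hT⟩ :=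
    (isCompact_closedBall (0 : EuclideanSpace ℝ (Fin 3) →L[ℝ] EuclideanSpace ℝ (Fin 3)) 1).tendsto_subseq
      hmem
  have hnorm : ∀ v, ‖T v‖ = ‖v‖ := fun v => by
    have h1 : Tendsto (fun k => (A (ψ k)).toContinuousLinearMap v) atTop (𝓝 (T v)) :=
      ((ContinuousLinearMap.apply ℝ (EuclideanSpace ℝ (Fin 3)) v).continuous.tendsto T).comp hT
    have h2 : Tendsto (fun k => ‖(A (ψ k)).toContinuousLinearMap v‖) atTop (𝓝 ‖T v‖) := h1.norm
    have h3 : (fun k => ‖(A (ψ k)).toContinuousLinearMap v‖) = fun _ => ‖v‖ :=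
      funext fun k => (A (ψ k)).norm_map v
    rw [h3] at h2
    exact tendsto_nhds_unique h2 tendsto_const_nhds
  refine ⟨ψ, hψ, ⟨T.toLinearMap, hnorm⟩, ?_⟩
  have hTe : (⟨T.toLinearMap, hnorm⟩ :
      EuclideanSpace ℝ (Fin 3) →ₗᵢ[ℝ] EuclideanSpace ℝ (Fin 3)).toContinuousLinearMap = T := by
    ext v
    rfl
  rw [hTe]
  exact hT

/-- **`ChargedPatternCrystallizes`** (item stmt-AtomisticToContinuum-2916): if the Lennard-Jones
ground states charge one periodic configuration with a positive density of good particles at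
every scale (`GroundStatesChargePeriodic`) and keep a uniform minimal distance
(`LennardJonesMinimalDistance`), then they crystallize in the sense of Blanc–Lewin 2015, §2.1
(15)–(17) (`IsCrystallizing lennardJones 3`), with multiplicity-one limit measure carried by a
rotated translate of the charged configuration. [cite: BlancLewin2015, §2.1 (16), §2.2] -/
theorem chargedPatternCrystallizes_proof :
    Summit.AtomisticToContinuum.Crystallization.Theses.PalmUnimodularRigidity.ChargedPatternCrystallizes := by
  intro hcharge hmin x hx
  obtain ⟨δ, hδ, hsep⟩ := hmin
  obtain ⟨Q, hQ⟩ := hcharge x hx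
  -- Step 1: one good particle at every scale, along a subsequence `φ₁`
  have hfreq : ∀ k : ℕ, ∃ᶠ N in atTop, ∃ i : Fin N,
      ∃ A : EuclideanSpace ℝ (Fin 3) →ₗᵢ[ℝ] EuclideanSpace ℝ (Fin 3), ∃ q ∈ Q.points,
      (∀ s ∈ Q.points, dist s q ≤ ((k : ℝ) + 1) →
          ∃ j : Fin N, dist (x N j) (x N i + A (s - q)) ≤ 1 / ((k : ℝ) + 1)) ∧
      (∀ j : Fin N, dist (x N j) (x N i) ≤ ((k : ℝ) + 1) →
          ∃ s ∈ Q.points, dist (x N j) (x N i + A (s - q)) ≤ 1 / ((k : ℝ) + 1)) := by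
    intro k
    obtain ⟨ρ, hρ, hfr⟩ := hQ ((k : ℝ) + 1) (1 / ((k : ℝ) + 1)) (by positivity) (by positivity)
    exact frequently_exists_of_frequently_card hρ hfr
  obtain ⟨φ₁, hφ₁, hgood⟩ := extraction_forall_of_frequently hfreq
  choose i A q hq hAB using hgood
  -- Step 2: the base points modulo the lattice take finitely many values: fix one, `y₀`
  have hq' : ∀ k, ∃ y ∈ Q.motif, q k - y ∈ Q.lattice := fun k => by
    obtain ⟨y, hy, g, hg, h⟩ := hq k
    exact ⟨y, hy, by rw [h, add_sub_cancel_left]; exact hg⟩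
  choose y hy hyq using hq'
  obtain ⟨y₀, -, hfy⟩ := exists_frequently_eq_of_forall_mem hy
  obtain ⟨ψ₁, hψ₁, hψ₁y⟩ := extraction_of_frequently_atTop hfy
  -- Step 3: compactness of the isometries along a further subsequence `ψ₂`
  obtain ⟨ψ₂, hψ₂, B, hB⟩ := exists_subseq_tendsto_linearIsometry fun k => A (ψ₁ k)
  have hψ : StrictMono (ψ₁ ∘ ψ₂) := hψ₁.comp hψ₂
  -- the limit configuration `B (Q - y₀)`
  set Be : EuclideanSpace ℝ (Fin 3) ≃ₗᵢ[ℝ] EuclideanSpace ℝ (Fin 3) :=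
    B.toLinearIsometryEquiv rfl
  set P : PeriodicConfiguration 3 := (Q.translate (-y₀)).isometryImage Be with hPdef
  have hP1 : ∀ t, t + y₀ ∈ Q.points → B t ∈ P.points := fun t ht => by
    rw [hPdef, PeriodicConfiguration.mem_points_isometryImage,
      PeriodicConfiguration.mem_points_translate]
    have : Be.symm (B t) = t := by
      rw [← LinearIsometry.coe_toLinearIsometryEquiv B rfl]
      exact Be.symm_apply_apply t
    simpa [this] using ht
  have hP2 : ∀ z ∈ P.points, ∃ t, t + y₀ ∈ Q.points ∧ z = B t := fun z hz => by
    rw [hPdef, PeriodicConfiguration.mem_points_isometryImage,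
      PeriodicConfiguration.mem_points_translate, sub_neg_eq_add] at hz
    refine ⟨Be.symm z, hz, ?_⟩
    rw [← LinearIsometry.coe_toLinearIsometryEquiv B rfl]
    exact (Be.apply_symm_apply z).symm
  -- the lattice relation of the base points along the final subsequence
  have hlat : ∀ k, q (ψ₁ (ψ₂ k)) - y₀ ∈ Q.lattice := fun k => by
    have := hyq (ψ₁ (ψ₂ k))
    rwa [hψ₁y (ψ₂ k)] at this
  refine ⟨φ₁ ∘ (ψ₁ ∘ ψ₂), fun k => -(x (φ₁ (ψ₁ (ψ₂ k))) (i (ψ₁ (ψ₂ k)))), P, fun _ => 1,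
    hφ₁.comp hψ, fun _ _ => le_rfl, fun _ _ _ => rfl, fun f hfc hf => ?_⟩
  -- Step 4: the local-convergence criterion
  refine P.tendsto_sum_of_eventually_near'
    (fun k j => x (φ₁ (ψ₁ (ψ₂ k))) j + -(x (φ₁ (ψ₁ (ψ₂ k))) (i (ψ₁ (ψ₂ k))))) hδ ?_ ?_ hfc hf
  · -- uniform minimal distance
    intro k j j' hjj'
    rw [dist_add_right]
    exact hsep _ _ (hx _) j j' hjj'
  · -- two-way matching on every ball, eventually
    intro R ε hε
    -- (i) the scale exceeds `|R| + 1`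
    have hψt : Tendsto (fun k => ((ψ₁ (ψ₂ k) : ℕ) : ℝ)) atTop atTop :=
      tendsto_natCast_atTop_atTop.comp hψ.tendsto_atTop
    have e1 : ∀ᶠ k in atTop, |R| ≤ ((ψ₁ (ψ₂ k) : ℕ) : ℝ) := hψt.eventually_ge_atTop _
    -- (ii) the tolerance is below `ε / 2`
    have e2 : ∀ᶠ k in atTop, 1 / (((ψ₁ (ψ₂ k) : ℕ) : ℝ) + 1) ≤ ε / 2 :=
      ((tendsto_one_div_add_atTop_nhds_zero_nat (𝕜 := ℝ)).comp hψ.tendsto_atTop).eventually_le_const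
        (half_pos hε)
    -- (iii) the isometries are `ε / 2 / (|R| + 1)`-close to the limit
    have hR1 : 0 < |R| + 1 := by positivity
    have e3 : ∀ᶠ k in atTop,
        ‖(A (ψ₁ (ψ₂ k))).toContinuousLinearMap - B.toContinuousLinearMap‖ < ε / 2 / (|R| + 1) := by
      have := (Metric.tendsto_nhds.1 hB) (ε / 2 / (|R| + 1)) (by positivity)
      simpa [dist_eq_norm] using this
    filter_upwards [e1, e2, e3] with k hk1 hk2 hk3
    -- abbreviations
    set N := φ₁ (ψ₁ (ψ₂ k))
    set i₀ := i (ψ₁ (ψ₂ k))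
    set Ak := A (ψ₁ (ψ₂ k))
    set qk := q (ψ₁ (ψ₂ k))
    obtain ⟨hA1, hA2⟩ := hAB (ψ₁ (ψ₂ k))
    have hRk : R ≤ ((ψ₁ (ψ₂ k) : ℕ) : ℝ) + 1 := by linarith [le_abs_self R]
    -- the operator-norm estimate on vectors of norm `≤ |R| + 1`
    have hop : ∀ t : EuclideanSpace ℝ (Fin 3), ‖t‖ ≤ |R| + 1 → dist (Ak t) (B t) ≤ ε / 2 := by
      intro t ht
      rw [dist_eq_norm]
      have h1 : Ak t - B t = (Ak.toContinuousLinearMap - B.toContinuousLinearMap) t := rfl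
      rw [h1]
      calc ‖(Ak.toContinuousLinearMap - B.toContinuousLinearMap) t‖
          ≤ ‖Ak.toContinuousLinearMap - B.toContinuousLinearMap‖ * ‖t‖ :=
            ContinuousLinearMap.le_opNorm _ _
        _ ≤ ε / 2 / (|R| + 1) * (|R| + 1) :=
            mul_le_mul hk3.le ht (norm_nonneg _) (by positivity)
        _ = ε / 2 := by field_simp
    refine ⟨fun s' hs' hs'R => ?_, fun j hjR => ?_⟩
    · -- sites of `P` in the ball are matched by particles
      obtain ⟨t, ht, rfl⟩ := hP2 s' hs'
      have htn : ‖t‖ ≤ R := by rwa [B.norm_map] at hs'R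
      -- the site `t + qk` of `Q` is within `R` of the base point `qk`
      have hsQ : t + qk ∈ Q.points := by
        have : t + qk = (t + y₀) + (qk - y₀) := by abel
        rw [this]
        exact Q.add_mem_points ht (hlat k)
      obtain ⟨j, hj⟩ := hA1 (t + qk) hsQ (by
        rw [dist_eq_norm, add_sub_cancel_right]; exact htn.trans hRk)
      refine ⟨j, ?_⟩
      rw [add_sub_cancel_right] at hj
      calc dist (x N j + -x N i₀) (B t)
          ≤ dist (x N j + -x N i₀) (Ak t) + dist (Ak t) (B t) := dist_triangle _ _ _
        _ ≤ 1 / (((ψ₁ (ψ₂ k) : ℕ) : ℝ) + 1) + ε / 2 := by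
            refine add_le_add ?_ (hop t (by linarith [le_abs_self R]))
            have : dist (x N j + -x N i₀) (Ak t) = dist (x N j) (x N i₀ + Ak t) := by
              rw [dist_eq_norm, dist_eq_norm]
              congr 1
              abel
            rw [this]
            exact hj
        _ ≤ ε / 2 + ε / 2 := add_le_add hk2 le_rfl
        _ = ε := by ring
    · -- particles in the ball are matched by sites of `P`
      have hjR' : dist (x N j) (x N i₀) ≤ ((ψ₁ (ψ₂ k) : ℕ) : ℝ) + 1 := by
        rw [dist_eq_norm, sub_eq_add_neg]
        exact hjR.trans hRk
      obtain ⟨s, hs, hjs⟩ := hA2 j hjR'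
      refine ⟨B (s - qk), hP1 (s - qk) ?_, ?_⟩
      · have : s - qk + y₀ = s + -(qk - y₀) := by abel
        rw [this]
        exact Q.add_mem_points hs (Q.lattice.neg_mem (hlat k))
      · have hd : dist (x N j + -x N i₀) (Ak (s - qk)) ≤ 1 / (((ψ₁ (ψ₂ k) : ℕ) : ℝ) + 1) := by
          have : dist (x N j + -x N i₀) (Ak (s - qk)) = dist (x N j) (x N i₀ + Ak (s - qk)) := by
            rw [dist_eq_norm, dist_eq_norm]
            congr 1
            abel
          rw [this]
          exact hjs
        have hk2' : 1 / (((ψ₁ (ψ₂ k) : ℕ) : ℝ) + 1) ≤ 1 := by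
          rw [div_le_one (by positivity)]
          linarith [(Nat.cast_nonneg (ψ₁ (ψ₂ k)) : (0 : ℝ) ≤ _)]
        have htn : ‖s - qk‖ ≤ |R| + 1 := by
          rw [← Ak.norm_map (s - qk)]
          have h1 : ‖Ak (s - qk)‖ ≤ ‖x N j + -x N i₀‖ + dist (x N j + -x N i₀) (Ak (s - qk)) := by
            rw [dist_eq_norm]
            exact norm_le_norm_add_norm_sub _ _
          linarith [le_abs_self R]
        calc dist (x N j + -x N i₀) (B (s - qk))
            ≤ dist (x N j + -x N i₀) (Ak (s - qk)) + dist (Ak (s - qk)) (B (s - qk)) :=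
              dist_triangle _ _ _
          _ ≤ 1 / (((ψ₁ (ψ₂ k) : ℕ) : ℝ) + 1) + ε / 2 := add_le_add hd (hop _ htn)
          _ ≤ ε / 2 + ε / 2 := add_le_add hk2 le_rfl
          _ = ε := by ring

end Summit.AtomisticToContinuum.Crystallization.Theorems

end
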